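import Summits.AtomisticToContinuum.BoseEinsteinCondensation.Theses.BECCellInformation
import Summits.AtomisticToContinuum.BoseEinsteinCondensation.Theorems.BECCellInformationCellInformationBoundCruxPosition

/-!
# Crux-strategist sketch R1 for `CellInformationBound` (stmt-AtomisticToContinuum-13439)

Typed census objects backing `STRATEGY-CENSUS-R1.md` (redirect strategist seat
`cstrat-stmt-AtomisticToContinuum-13439-r1`, 2026-08-17).  Second opinion with a different
technique inventory (directed polymers in random environment / weak disorder, Bose-polaron
residue and the orthogonality catastrophe, Bhattacharyya–Jensen residue bounds, reference-state
chain rules).  Nothing here is registered as a line: every `def … : Prop` is a census object and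
the theorems are sorry-free glue certifying which piece of each split carries the crux.

Notation (route file): `Ψ ∈ TrialState (n+1) L`, `L = sideLength ρ (n+1)`, `M = ⌈L/l⌉₊`, cells
`k : Fin 3 → Fin M`; `A_k(Y) = ∫_(cell k) |Ψ(x,Y)|² dx` (`cellWeight`), `m(Y) = ∫ |Ψ(z,Y)|² dz`
(`mass`), `P_k = ∫ A_k dY'` (`cellProb`).  `cellMI ρ l n Ψ` is VERBATIM the crux's left-hand side
`E_{Y∼m} KL(Q(·|Y) ‖ P) = I(cell_l(x₁); Y)` once the abbreviations are unfolded (`crux_iff` is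
`Iff.rfl`).

NEW OBJECT of this census: a bath REFERENCE state `Φ ∈ TrialState n L` (n bodies in the SAME box)
and the insertion field `Z(x,Y) = Ψ(x,Y)/(φ(x)Φ(Y))`; the coarse residue entropy
`coarseResidueEntropy ρ l n Ψ Φ = KL(P_{KY} ‖ P_K ⊗ |Φ|²) = I(K;Y) + KL(m ‖ |Φ|²)` (chain rule), so
`cellMI ≤ coarseResidueEntropy` for every admissible reference (`ChainRuleDominance`, provable now)
and the crux follows from the ONE-PIECE strengthening `CoarseResidueEntropyBound` — the entropy
version of the sibling routes' "no orthogonality catastrophe for one inserted particle" cruxes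
(stmt-12057/13801 BECBathMassLiouville, 12058 BECInsertionCorrector, 12310 BECProbeMassFlow,
12064 BECInsertionVariance).  See the census for why this is a map of the cluster, not a lever.
-/

namespace Summit.AtomisticToContinuum.BoseEinsteinCondensation.Cruxes.CellInformationBound.StrategistR1

open scoped BigOperators Topology Classical MeasureTheory ENNReal
open Filter Set MeasureTheory
open Literature.MathematicalPhysics.QuantumManyBody.BoseGas
open Summit.AtomisticToContinuum.BoseEinsteinCondensation.Theses.BECCellInformation

/-! ## Abbreviations (definitionally the crux's sub-expressions) -/

/-- The half-open congruent sub-cube of side `L/M` indexed by `k`. -/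
def cellSet (ρ l : ℝ) (n : ℕ) (k : Fin 3 → Fin ⌈sideLength ρ (n + 1) / l⌉₊) :
    Set (EuclideanSpace ℝ (Fin 3)) :=
  {y : EuclideanSpace ℝ (Fin 3) | ∀ j, y j ∈ Set.Ico (((k j : ℕ) : ℝ) * (sideLength ρ (n + 1) / (⌈sideLength ρ (n + 1) / l⌉₊ : ℝ))) ((((k j : ℕ) : ℝ) + 1) * (sideLength ρ (n + 1) / (⌈sideLength ρ (n + 1) / l⌉₊ : ℝ)))}

/-- `A_k(Y) = ∫_(cell k) |Ψ(x :: Y)|² dx`, the insertion weight of cell `k` given the bath `Y`. -/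
noncomputable def cellWeight (ρ l : ℝ) (n : ℕ) (Ψ : TrialState (n + 1) (sideLength ρ (n + 1)))
    (k : Fin 3 → Fin ⌈sideLength ρ (n + 1) / l⌉₊) (Y : Config n) : ℝ :=
  ∫ x in cellSet ρ l n k, ‖Ψ.ψ (Matrix.vecCons x Y)‖ ^ 2

/-- `P_k = ∫ A_k(Y') dY' = ℙ(x₁ ∈ cell k)`. -/
noncomputable def cellProb (ρ l : ℝ) (n : ℕ) (Ψ : TrialState (n + 1) (sideLength ρ (n + 1)))
    (k : Fin 3 → Fin ⌈sideLength ρ (n + 1) / l⌉₊) : ℝ :=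
  ∫ Y' : Config n, cellWeight ρ l n Ψ k Y'

/-- The bath marginal density `m(Y) = ∫ |Ψ(z :: Y)|² dz`. -/
noncomputable def mass {n : ℕ} {L : ℝ} (Ψ : TrialState (n + 1) L) (Y : Config n) : ℝ :=
  ∫ z, ‖Ψ.ψ (Matrix.vecCons z Y)‖ ^ 2

/-- The crux functional `I(cell_l(x₁);Y) = ∫ dY Σ_k m P_k klFun(A_k/(m P_k))`. -/
noncomputable def cellMI (ρ l : ℝ) (n : ℕ) (Ψ : TrialState (n + 1) (sideLength ρ (n + 1))) : ℝ≥0∞ :=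
  ∫⁻ Y : Config n, ENNReal.ofReal (∑ k : Fin 3 → Fin ⌈sideLength ρ (n + 1) / l⌉₊,
    mass Ψ Y * cellProb ρ l n Ψ k * InformationTheory.klFun (cellWeight ρ l n Ψ k Y / (mass Ψ Y * cellProb ρ l n Ψ k)))

/-- Sanity: the crux is literally `… → cellMI ρ l n Ψ ≤ ofReal C` (definitional unfolding). -/
theorem crux_iff :
    CellInformationBound ↔
    (∀ v : ℝ → ENNReal, IsRepulsiveFiniteRange v → ∃ ρ₀ : ℝ, 0 < ρ₀ ∧ ∀ ρ : ℝ, 0 < ρ → ρ < ρ₀ →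
      ∃ l : ℝ, 0 < l ∧ ∃ C : ℝ, ∀ᶠ n : ℕ in Filter.atTop, ∃ δ : ENNReal, 0 < δ ∧
        ∀ Ψ : TrialState (n + 1) (sideLength ρ (n + 1)),
          energy v Ψ ≤ groundStateEnergy v (n + 1) (sideLength ρ (n + 1)) + δ →
          (∀ X, Ψ.ψ X = (‖Ψ.ψ X‖ : ℂ)) → cellMI ρ l n Ψ ≤ ENNReal.ofReal C) :=
  Iff.rfl

/-! ## Strengthen (S⁺_R1): the coarse residue entropy w.r.t. a bath reference state -/

/-- `KL(P_{KY} ‖ P_K ⊗ |Φ|²) = ∫ dY Σ_k |Φ(Y)|² P_k klFun(A_k(Y)/(|Φ(Y)|² P_k))`: the relative entropy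
of the joint law of (cell of the tagged particle, bath) with respect to the PRODUCT of its cell
marginal and a REFERENCE bath density `|Φ|²` (`Φ ∈ TrialState n L`, `n` bodies in the same box).
Chain rule: `= I(K;Y) + KL(m ‖ |Φ|²)` whenever `m ≪ |Φ|²`.  For `Ψ = Ψ₀^(n+1)`, `Φ = Ψ₀^(n)` each
summand is `P_k · E_{|Φ₀|²}[klFun(a_k/P_k)]` with `a_k(Y) = A_k(Y)/Φ₀(Y)² = ∫_k φ_D² Z(·,Y)²` the
CELL-INSERTION WEIGHT of one extra particle relative to the bath ground state — a sum of
local-looking entropy moments, no cross-cell normaliser (it enters `I` with the favourable sign). -/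
noncomputable def coarseResidueEntropy (ρ l : ℝ) (n : ℕ)
    (Ψ : TrialState (n + 1) (sideLength ρ (n + 1))) (Φ : TrialState n (sideLength ρ (n + 1))) : ℝ≥0∞ :=
  ∫⁻ Y : Config n, ENNReal.ofReal (∑ k : Fin 3 → Fin ⌈sideLength ρ (n + 1) / l⌉₊,
    ‖Φ.ψ Y‖ ^ 2 * cellProb ρ l n Ψ k * InformationTheory.klFun (cellWeight ρ l n Ψ k Y / (‖Φ.ψ Y‖ ^ 2 * cellProb ρ l n Ψ k)))

/-- **Chain-rule dominance (PROVABLE NOW, size M).**  For every reference `Φ` with `m ≪ |Φ|²`: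
`I(K;Y) ≤ KL(P_{KY} ‖ P_K ⊗ |Φ|²)`.  Pointwise in `Y` with `w = |Φ(Y)|² > 0`, using `Σ_k A_k = m`
(the cells tile `[0,L)³ ⊇ box`) and `Σ_k P_k = ‖Ψ‖² = 1`:
`Σ_k [w P_k klFun(A_k/(w P_k)) − m P_k klFun(A_k/(m P_k))] = w · klFun(m/w) ≥ 0`. -/
def ChainRuleDominance : Prop :=
  ∀ (ρ l : ℝ) (n : ℕ) (Ψ : TrialState (n + 1) (sideLength ρ (n + 1)))
    (Φ : TrialState n (sideLength ρ (n + 1))),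
    (∀ᵐ Y : Config n, Φ.ψ Y = 0 → mass Ψ Y = 0) → cellMI ρ l n Ψ ≤ coarseResidueEntropy ρ l n Ψ Φ

/-- **S⁺_R1 (OPEN; implies the crux; entropy form of "no orthogonality catastrophe on inserting one
particle").**  Same prefix as the crux; for each non-negative `δ`-near-minimiser `Ψ` of the
`(n+1)`-body energy there is a `δ`-near-minimiser `Φ` of the `n`-BODY energy in the SAME box with
`m_Ψ ≪ |Φ|²` and `KL(P_{KY} ‖ P_K ⊗ |Φ|²) ≤ C`.  Quantifier audit: the `∀ Φ`-near-minimiser form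
is FALSE (configuration-space dips of `Φ` cost energy `O(L⁻²) ≪ δ` and send `KL(m‖|Φ|²) → ∞`,
`DipRefutesForallReference`); the unconstrained `∃ Φ` form is the TARGET 13438 itself (`Φ² ≈ m`).
Only the constrained `∃ Φ near-minimiser` form typed here is a genuine strengthening. -/
def CoarseResidueEntropyBound : Prop :=
  ∀ v : ℝ → ENNReal, IsRepulsiveFiniteRange v → ∃ ρ₀ : ℝ, 0 < ρ₀ ∧ ∀ ρ : ℝ, 0 < ρ → ρ < ρ₀ →
    ∃ l : ℝ, 0 < l ∧ ∃ C : ℝ, ∀ᶠ n : ℕ in Filter.atTop, ∃ δ : ENNReal, 0 < δ ∧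
      ∀ Ψ : TrialState (n + 1) (sideLength ρ (n + 1)),
        energy v Ψ ≤ groundStateEnergy v (n + 1) (sideLength ρ (n + 1)) + δ →
        (∀ X, Ψ.ψ X = (‖Ψ.ψ X‖ : ℂ)) →
        ∃ Φ : TrialState n (sideLength ρ (n + 1)),
          energy v Φ ≤ groundStateEnergy v n (sideLength ρ (n + 1)) + δ ∧
          (∀ᵐ Y : Config n, Φ.ψ Y = 0 → mass Ψ Y = 0) ∧
          coarseResidueEntropy ρ l n Ψ Φ ≤ ENNReal.ofReal C

/-- Glue (sorry-free): the crux from S⁺_R1 and the chain rule.  The strengthening is ONE piece —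
this is a Strengthen entry, not a decomposition. -/
theorem crux_of_coarseResidueEntropyBound (hS : CoarseResidueEntropyBound)
    (hC : ChainRuleDominance) : CellInformationBound := by
  rw [crux_iff]
  intro v hv
  obtain ⟨ρ₀, hρ₀, h⟩ := hS v hv
  refine ⟨ρ₀, hρ₀, fun ρ hρ hρ' => ?_⟩
  obtain ⟨l, hl, C, hC'⟩ := h ρ hρ hρ'
  refine ⟨l, hl, C, ?_⟩
  filter_upwards [hC'] with n hn
  obtain ⟨δ, hδ, hΨ⟩ := hn
  refine ⟨δ, hδ, fun Ψ hE hpos => ?_⟩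
  obtain ⟨Φ, -, hac, hb⟩ := hΨ Ψ hE hpos
  exact (hC ρ l n Ψ Φ hac).trans hb

/-! ## The residue dictionary (Transfer objects) -/

/-- **Bhattacharyya–Jensen residue bound (PROVABLE NOW, size M).**  For non-negative `Ψ` (N = n+1
bodies), non-negative reference `Φ` (n bodies) and a non-negative normalised one-body mode `φ`
with `Ψ² ≪ φ² ⊗ Φ²`:  `occupation N φ Ψ ≥ N·|⟨φ ⊗ Φ, Ψ⟩|² ≥ N·exp(−KL(Ψ² ‖ φ² ⊗ Φ²))`
(Cauchy–Schwarz in `L²(dY)` with `‖Φ‖ = 1`, then `∫√(PR) ≥ exp(−KL(P‖R)/2)` by Jensen).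
With `Φ = Ψ₀^(n)`: the condensate fraction dominates the ONE-PARTICLE INSERTION RESIDUE, which in
turn is `≥ exp(−fine residue entropy)`.  This is the entropy-side of `ResidueCondenses`
(BECInsertionCorrector / BECBathMassLiouville, landed) and places the FINE residue entropy above
both this crux (via `ChainRuleDominance` + data processing) and the sibling target
`InsertionResidue` (stmt-12057 → 13801 chain). Typed with an explicit bound `C` (no junk `toReal`). -/
def ResidueLowerBound : Prop :=
  ∀ (n : ℕ) (L : ℝ) (Ψ : TrialState (n + 1) L) (Φ : TrialState n L) (φ : Space → ℂ) (C : ℝ),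
    (∀ X, Ψ.ψ X = (‖Ψ.ψ X‖ : ℂ)) → (∀ Y, Φ.ψ Y = (‖Φ.ψ Y‖ : ℂ)) → (∀ x, φ x = (‖φ x‖ : ℂ)) →
    Measurable φ → (∫ x, ‖φ x‖ ^ 2 = 1) →
    (∀ X : Config (n + 1), φ (X 0) * Φ.ψ (Matrix.vecTail X) = 0 → Ψ.ψ X = 0) →
    ∫⁻ X : Config (n + 1), ENNReal.ofReal (‖φ (X 0)‖ ^ 2 * ‖Φ.ψ (Matrix.vecTail X)‖ ^ 2 *
        InformationTheory.klFun (‖Ψ.ψ X‖ ^ 2 / (‖φ (X 0)‖ ^ 2 * ‖Φ.ψ (Matrix.vecTail X)‖ ^ 2)))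
      ≤ ENNReal.ofReal C →
    ENNReal.ofReal ((n + 1 : ℝ) * Real.exp (-C)) ≤ occupation (n + 1) φ Ψ.ψ

/-! ## Negation objects -/

/-- **Dips refute the `∀ Φ` form (why S⁺_R1 is typed `∃ Φ`).**  For every `η > 0` and every
n-body trial state `Φ` there is a trial state `Φ'` with energy at most `energy Φ + η` whose square
is `≤ ε²|Φ|²` on a set of `m_Ψ`-mass `≥ 1/2` (a smooth dip along ONE bath coordinate over length
`L`, kinetic cost `O(L⁻²)`), whence `KL(m_Ψ ‖ |Φ'|²) ≥ ½ log ε⁻² − log 2 → ∞`: reference-state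
entropy bounds quantified over ALL near-minimisers of the REFERENCE are refutable at vanishing
energy cost (the crux's own `δ`-after-`n` protects `Ψ`, nothing protects `Φ`).  Recorded as the
statement a disprover would land; not needed by any glue here. -/
def DipRefutesForallReference : Prop :=
  ∀ v : ℝ → ENNReal, IsRepulsiveFiniteRange v → ∀ ρ l C : ℝ, 0 < ρ → 0 < l →
    ∀ᶠ n : ℕ in Filter.atTop, ∀ δ : ENNReal, 0 < δ →
      ∀ Ψ : TrialState (n + 1) (sideLength ρ (n + 1)), (∀ X, Ψ.ψ X = (‖Ψ.ψ X‖ : ℂ)) →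
        groundStateEnergy v n (sideLength ρ (n + 1)) ≠ ⊤ →
        ∃ Φ : TrialState n (sideLength ρ (n + 1)),
          energy v Φ ≤ groundStateEnergy v n (sideLength ρ (n + 1)) + δ ∧
          (∀ᵐ Y : Config n, Φ.ψ Y = 0 → mass Ψ Y = 0) ∧
          ENNReal.ofReal C < coarseResidueEntropy ρ l n Ψ Φ

/-! ## Pointers (in-tree facts this census leans on, by name)

* crux ⇒ positive-sector zero-mode BEC and crux ∧ 9072 ⇒ S:
  `Summit.AtomisticToContinuum.BoseEinsteinCondensation.Theorems.CellInformationBound.zeroModeBound_of_cellInformationBound`,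
  `….boseEinsteinCondensation_of_cellInformationBound`, `….cellInformationBound_iff_condEntropyBound`
  (p166914) — the summit-strength certificates the tribunal needs.
* ceiling `I ≤ log M³`: `….CellInformationBound.Ceiling.cellInformation_le_log` (p163888).
* s1 census objects (core / transfer / weak form / ess-sup / rigid potential):
  `Summit.AtomisticToContinuum.BoseEinsteinCondensation.Cruxes.CellInformationBound.Strategist.*`
  in `StrategySketch.lean` of this crux directory.
-/

example : CellInformationBound → GroundStateRigidity → _root_.BoseEinsteinCondensation :=
  Summit.AtomisticToContinuum.BoseEinsteinCondensation.Theorems.CellInformationBound.boseEinsteinCondensation_of_cellInformationBound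

end Summit.AtomisticToContinuum.BoseEinsteinCondensation.Cruxes.CellInformationBound.StrategistR1
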